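import Summits.BirchSwinnertonDyer.BirchSwinnertonDyer.Theorems.EisensteinPrimesUnrSelmerQuotientCorankGeOfSurjective
import Summits.BirchSwinnertonDyer.BirchSwinnertonDyer.Theorems.EisensteinPrimesUnramifiedLeAwayKer
import Summits.BirchSwinnertonDyer.BirchSwinnertonDyer.Theorems.EisensteinPrimesDecompositionCountNumPlaces
import Summits.BirchSwinnertonDyer.BirchSwinnertonDyer.Theorems.EisensteinPrimesNumPlacesAboveRepresentatives
import Summits.BirchSwinnertonDyer.Rank1Residual.Iwasawa.UnramifiedConditionFiniteOrbit
import HarnessLib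

/-!
# The natural localisation `H¹_{𝓕_nr^{Sf}}(K_∞, M) → ∏_{w∈Sf} ∏_{i<[Γ:Γ_w]} H¹(ker κ ⊓ D_w, M)`,
# `c ↦ (res_{ker κ ⊓ D_w} conj_{γ^i} c)_{w,i}`, HAS KERNEL `H¹_{𝓕_nr}(K_∞, M)`; hence its SURJECTIVITY alone
# gives `Σ_{w∈Sf} charLocalLambda ∅ κ θ w ≤ zpCorank (H¹_{𝓕_nr^{Sf}}/H¹_{𝓕_nr})` for `M = (F/𝒪)(θ)`

Cell `bsd-eis` (home `run/shared/lean/pub/bsd-eis/`), seat `bsd-line-x1-p1-w2` (gen 1; D-0154 width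
seat on crux 2 `GoodLatticeBDPValue` = stmt-BirchSwinnertonDyer-19032, line `halves` v16, stub
`stub_imprimCorank` = `KellerYin2024.prop125_residualPair_unrSelmer_corank_ge`). Sequel of
`EisensteinPrimesUnrSelmerQuotientCorankGeOfSurjective` (corank bookkeeping from ANY surjection with
kernel `H¹_{𝓕_nr}`). Here the surjection is pinned to the CANONICAL map — the one both roads produce
(road (A): LEAD g2's `K_∞`-side surjectivity "LocSurj" after the Shapiro descent; road (B):
`PollackWeston2011.SelmerStructure.toCalH` with `loc w = ⊥`) — and its KERNEL is computed in the
kernel from tree lemmas, so that the `≥` half of KY Prop. 1.2.5 for `(F/𝒪)(θ)` is reduced to ONE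
statement: the surjectivity of the canonical map.

* §1 `mem_unrSelmer_empty_iff_forall_resOfLe_conjH1_eq_zero` — GENERIC discrete `p`-primary `M` with
  open stabilisers, any `ℤ_p`-extension `κ` with topological generator `γ`, `Sf` a finite set of
  places `w ∤ p` finitely decomposed in `K_∞`: for `c ∈ H¹_{𝓕_nr^{Sf}}(K_∞, M)`,
  **`c ∈ H¹_{𝓕_nr}(K_∞, M) ↔ ∀ w ∈ Sf, ∀ i < N w, res_{ker κ ⊓ D_w}(conj_{γ^i} c) = 0`** for any
  `N` with `N w = numPlacesAbove κ w` on `Sf` (e.g. `N w = p^{a_w}`, adapter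
  `numPlacesAbove_eq_pow_of_forall_dvd` from the exponent currency `(a, hdiv, hd₀)`)
  (⇒: unramified ⇒ locally trivial above a finitely decomposed `w ∤ p`, the tree's
  `UnramifiedLeAwayKer.unramifiedKer_le_awayKer_of_not_decomp_le`; ⇐: locally trivial ⇒ unramified at
  the `[Γ:Γ_w]` representatives `γ^i`, then at EVERY conjugate by `Γ_K = ker κ · D_w · {γ^i}`, the
  tree's `hrep_numPlacesAbove` + `forall_conjH1_mem_unramifiedKer_of_forall_lt`);
  `ker_pi_resOfLe_conjH1_eq` — the bundled form: the kernel of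
  `c ↦ (res_{ker κ ⊓ D_w} conj_{γ^i} c)_{w∈Sf, i<N w}` on `H¹_{𝓕_nr^{Sf}}` IS `H¹_{𝓕_nr}`;
  `toAdd_apply_pow_of_isTopGenerator` (`κ(γ^i) = i`: the `γ^i` are admissible `σrep w i`);
  `surjective_pi_of_forall_exists` (the `∃ u ∈ Sel^{Sf}, ∀ w i, f w i u = y w i` form of a
  surjectivity statement, bundled).
* §2 **`sum_charLocalLambda_le_zpCorank_unrSelmer_quotient_of_pi_surjective`** — for
  `M = (F/𝒪)(θ)`, `θ^{p−1} = 1`: if the canonical map is SURJECTIVE then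
  `Σ_{w∈Sf} charLocalLambda ∅ κ θ w ≤ zpCorank (H¹_{𝓕_nr^{Sf}}/H¹_{𝓕_nr}) p`
  (§1 + `UnrSelmerQuotientCorankGeOfSurjective` + the per-place lower bound of KY Lemma 1.1.1); and
  **`…_at_residualPair_of_pi_surjective`** under the binders of `prop125_residualPair_unrSelmer_corank_ge`
  (`K` imaginary quadratic, `2 < p`, (Heeg), `κ` anticyclotomic, `θ ∈ {θsub, θquot}`, `Sf` = primes
  over `N` off `p`): the stub's conclusion from the SURJECTIVITY OF THE CANONICAL MAP alone.

HONEST FRAMING: tool theorems only (no definition — the canonical map is written inline as an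
`AddMonoidHom.pi` term —, no named fact, no `sorry`); the surjectivity is a HYPOTHESIS (PW Prop.
A.2 / Greenberg Prop. 2.6.3 + [RH] + local Shapiro, other seats' files); closes nothing by itself
(`--supports stmt-BirchSwinnertonDyer-19032`); BSD / Mazur's MC / IMC is proved for no curve here.

References: Keller–Yin arXiv:2402.12781v2 Prop. 1.2.5 (TeX L780–800), Rem. 1.2.3 (i) (L685–690),
Lemma 1.1.1; Greenberg–Vatsal, Invent. Math. 142 (2000) §2 pp. 17, 20–22; Greenberg, Adv. Stud.
Pure Math. 17 (1989) §1 p. 98; Pollack–Weston, Compositio 147 (2011) App. A Prop. A.2.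
-/

-- `Summit.BirchSwinnertonDyer.BirchSwinnertonDyer.…`: summit and sub-problem share a name (D-0017 layout).
set_option linter.dupNamespace false
set_option autoImplicit false

noncomputable section

open scoped Classical AddSubgroup Pointwise

open CategoryTheory Function Filter Polynomial NumberField IsDedekindDomain Field ValuativeRel
open Literature.NumberTheory.EllipticCurves Literature.NumberTheory.EllipticCurves.GreenbergSelmer
  Literature.NumberTheory.EllipticCurves.GreenbergVatsal2000
  Literature.NumberTheory.GaloisRepresentations
  Literature.NumberTheory.EllipticCurves.KellerYin2024 Literature.NumberTheory.IwasawaTheory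
  IsDedekindDomain.HeightOneSpectrum
  Summit.BirchSwinnertonDyer.Rank1Residual
  Summit.BirchSwinnertonDyer.Rank1Residual.Iwasawa
  Summit.BirchSwinnertonDyer.Rank1Residual.X2.NonPrimitiveQuotientCorank
  Summit.BirchSwinnertonDyer.BirchSwinnertonDyer.Theorems.DecompositionCountNumPlaces
  Summit.BirchSwinnertonDyer.BirchSwinnertonDyer.Theorems.UnramifiedLeAwayKer
  Summit.BirchSwinnertonDyer.BirchSwinnertonDyer.Theorems.UnrSelmerQuotientCorankGeOfSurjective

namespace Summit.BirchSwinnertonDyer.BirchSwinnertonDyer.Theorems.UnrSelmerNaturalLocalization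

variable {K : Type} [Field K] [NumberField K] {p : ℕ} [hp : Fact p.Prime] (κ : ZpExtension K p)

/-! ## §1 The kernel of the natural localisation on `H¹_{𝓕_nr^{Sf}}` is `H¹_{𝓕_nr}` -/

section Generic

variable {M : Type} [AddCommGroup M] [DistribMulAction (absoluteGaloisGroup K) M] [TopologicalSpace M]
  [DiscreteTopology M]

/-- Locally trivial ⇒ unramified at the chosen place: `res_{ker κ ⊓ D_w} x = 0 ⇒ x ∈ unramifiedKer`
(the restriction to `ker κ ⊓ I_w` factors through `ker κ ⊓ D_w`). [cite: GreenbergVatsal2000, §2 p. 17] -/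
theorem mem_unramifiedKer_of_resOfLe_eq_zero (w : HeightOneSpectrum (𝓞 K))
    {x : Literature.NumberTheory.EllipticCurves.subgroupH1 κ.kerSubgroup M}
    (hx : resOfLe M (inf_le_left : κ.kerSubgroup ⊓ decomp (K := K) w ≤ κ.kerSubgroup) x = 0) :
    x ∈ GreenbergVatsal2000.unramifiedKer κ.kerSubgroup M w := by
  -- the inclusion `inertiaIn (ker κ) w → ker κ ⊓ D_w`
  let j : inertiaIn κ.kerSubgroup w →ₜ* (κ.kerSubgroup ⊓ decomp (K := K) w : Subgroup _) :=
    { toFun := fun z ↦ ⟨((z : decomp (K := K) w) : absoluteGaloisGroup K),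
        Subgroup.mem_inf.mpr ⟨((mem_inertiaIn_iff κ.kerSubgroup w _).1 z.2).1,
          (z : decomp (K := K) w).2⟩⟩
      map_one' := rfl
      map_mul' := fun _ _ ↦ rfl
      continuous_toFun := (continuous_subtype_val.comp continuous_subtype_val).subtype_mk _ }
  have hfac : resH1Hom (inertiaInToH κ.kerSubgroup w) (AddMonoidHom.id M) (fun _ _ ↦ rfl) =
      (resH1Hom j (AddMonoidHom.id M) fun _ _ ↦ rfl).comp
        (resOfLe M (inf_le_left : κ.kerSubgroup ⊓ decomp (K := K) w ≤ κ.kerSubgroup)) := by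
    rw [resOfLe, resH1Hom_comp]
    exact resH1Hom_congr (by ext; rfl) (by ext; rfl) _ _
  rw [GreenbergVatsal2000.unramifiedKer, AddMonoidHom.mem_ker, hfac, AddMonoidHom.comp_apply, hx,
    map_zero]

/-- **`numPlacesAbove κ w = p ^ a`** when `p^a` divides every `κ δ`, `δ ∈ D_w`, and is attained
(the exponent currency `(a, hdiv, hd₀)` of the cell's local Shapiro files): the attaining `δ₀` is
valuation-minimal, so `numPlacesAbove_eq_pow_valuation` applies. [cite: GreenbergVatsal2000, §2 p. 21]
[cite: KellerYin2024, Lemma 1.0.1 (arXiv:2402.12781v2 TeX L388)] -/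
theorem numPlacesAbove_eq_pow_of_forall_dvd (w : HeightOneSpectrum (𝓞 K)) {a : ℕ}
    (hdiv : ∀ δ ∈ decomp (K := K) w, (p : ℤ_[p]) ^ a ∣ (κ δ).toAdd)
    (hd₀ : ∃ δ ∈ decomp (K := K) w, (κ δ).toAdd = (p : ℤ_[p]) ^ a) :
    numPlacesAbove κ w = p ^ a := by
  have hpr : (p : ℕ).Prime := Fact.out
  obtain ⟨δ₀, hδ₀, hκδ₀⟩ := hd₀
  have hpa : ((p : ℤ_[p]) ^ a) ≠ 0 := pow_ne_zero _ (by exact_mod_cast hpr.ne_zero)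
  have hval : ((κ δ₀).toAdd).valuation = a := by
    rw [hκδ₀, ← mul_one ((p : ℤ_[p]) ^ a), PadicInt.valuation_p_pow_mul a 1 one_ne_zero,
      PadicInt.valuation_one, add_zero]
  have hne : κ δ₀ ≠ 1 := fun h ↦ by
    have h0 : (κ δ₀).toAdd = 0 := by rw [h, toAdd_one]
    exact hpa (hκδ₀ ▸ h0)
  have hmin : ∀ δ ∈ decomp (K := K) w, κ δ ≠ 1 →
      ((κ δ₀).toAdd).valuation ≤ ((κ δ).toAdd).valuation := by
    intro δ hδ hne'
    obtain ⟨t, ht⟩ := hdiv δ hδ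
    have ht0 : t ≠ 0 := fun h0 ↦ hne' (by
      have : (κ δ).toAdd = 0 := by rw [ht, h0, mul_zero]
      rw [← ofAdd_toAdd (κ δ), this]; rfl)
    rw [hval, ht, PadicInt.valuation_p_pow_mul a t ht0]
    exact Nat.le_add_right a _
  rw [NumPlacesAboveRepresentatives.numPlacesAbove_eq_pow_valuation κ w hδ₀ hne hmin, hval]

omit [NumberField K] in
/-- `κ (γ^i) = i` (additively) for a topological generator `γ` (`κ γ = 1`): the powers `γ^i`,
`i < p^{a_w}`, are admissible representatives `σrep w i` of the cell's local Shapiro surjectivity.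
[folklore] -/
theorem toAdd_apply_pow_of_isTopGenerator {γ : absoluteGaloisGroup K} (hγ : κ.IsTopGenerator γ) (i : ℕ) :
    (κ (γ ^ i)).toAdd = (i : ℤ_[p]) := by
  rw [map_pow, hγ, ← ofAdd_nsmul, toAdd_ofAdd, nsmul_one]

omit [NumberField K] in
/-- **Bundling**: if every family of local targets `y w i` (`w ∈ Sf`, `i < N w`) is realised by some
`u ∈ SS` under maps `f w i`, then the bundled map `SS → ∏_{w∈Sf} ∏_{i<N w}` is SURJECTIVE (the
`∃`-form of the cell's `K_∞`-side global-to-local surjectivity, repackaged). [folklore] -/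
theorem surjective_pi_of_forall_exists {G : Type*} [AddCommGroup G] (SS : AddSubgroup G)
    (Sf : Finset (HeightOneSpectrum (𝓞 K))) (N : HeightOneSpectrum (𝓞 K) → ℕ)
    {Y : HeightOneSpectrum (𝓞 K) → Type} [∀ w, AddCommGroup (Y w)]
    (f : (w : HeightOneSpectrum (𝓞 K)) → ℕ → (G →+ Y w))
    (h : ∀ y : (w : HeightOneSpectrum (𝓞 K)) → ℕ → Y w, ∃ u ∈ SS, ∀ w ∈ Sf, ∀ i < N w, f w i u = y w i) :
    Surjective ((AddMonoidHom.pi fun w : ↥Sf ↦ AddMonoidHom.pi fun i : Fin (N (w : HeightOneSpectrum (𝓞 K))) ↦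
        f (w : HeightOneSpectrum (𝓞 K)) (i : ℕ)).comp SS.subtype) := by
  intro t
  obtain ⟨u, hu, h'⟩ := h fun w i ↦
    if hw : w ∈ Sf then (if hi : i < N w then t ⟨w, hw⟩ ⟨i, hi⟩ else 0) else 0
  refine ⟨⟨u, hu⟩, funext fun w ↦ funext fun i ↦ ?_⟩
  have e := h' w w.2 i i.2
  rw [dif_pos w.2, dif_pos i.2] at e
  exact e

/-- **For `c ∈ H¹_{𝓕_nr^{Sf}}(K_∞, M)`: `c ∈ H¹_{𝓕_nr}(K_∞, M)` iff `res_{ker κ ⊓ D_w}(conj_{γ^i} c) = 0`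
for every `w ∈ Sf` and every `i < [Γ:Γ_w] = numPlacesAbove κ w`** — `M` discrete `p`-primary with
open stabilisers, `κ` any `ℤ_p`-extension with topological generator `γ`, any Greenberg datum at
`p` (here KY's `bdpData M p v̄`), `Sf` a finite set of places `w ∤ p` finitely decomposed in `K_∞`.
(⇒) unramified ⇒ locally trivial above such `w` (`unramifiedKer_le_awayKer_of_not_decomp_le`:
`Gal(K̄_w/K_{∞,η})/I_w` is pro-prime-to-`p`), at every conjugate; (⇐) locally trivial ⇒ unramified
at the representatives `γ^i`, hence at every `σ ∈ Γ_K = ker κ · D_w · {γ^i : i < [Γ:Γ_w]}`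
(`hrep_numPlacesAbove`, `forall_conjH1_mem_unramifiedKer_of_forall_lt`). KY Rem. 1.2.3 (i) /
Greenberg 1989 p. 98 ("one could replace `I_v` by `D_v`"). [cite: KellerYin2024, Rem. 1.2.3 (i) (arXiv:2402.12781v2 TeX L685–690)]
[cite: GreenbergVatsal2000, §2 pp. 17, 20–21] [cite: Greenberg1989, §1 p. 98] -/
theorem mem_unrSelmer_empty_iff_forall_resOfLe_conjH1_eq_zero
    (hstab : ∀ m : M, IsOpen (MulAction.stabilizer (absoluteGaloisGroup K) m : Set (absoluteGaloisGroup K)))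
    (hM : ∀ m : M, ∃ k : ℕ, p ^ k • m = 0) {γ : absoluteGaloisGroup K} (hγ : κ.IsTopGenerator γ)
    (vbar : HeightOneSpectrum (𝓞 K)) (Sf : Finset (HeightOneSpectrum (𝓞 K)))
    (hSfp : ∀ w ∈ Sf, ((p : ℕ) : 𝓞 K) ∉ w.asIdeal)
    (hSfdec : ∀ w ∈ Sf, ∃ δ ∈ decomp (K := K) w, κ δ ≠ 1)
    (N : HeightOneSpectrum (𝓞 K) → ℕ) (hN : ∀ w ∈ Sf, N w = numPlacesAbove κ w)
    {c : Literature.NumberTheory.EllipticCurves.subgroupH1 κ.kerSubgroup M}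
    (hc : c ∈ unrSelmer κ M vbar (↑Sf : Set (HeightOneSpectrum (𝓞 K)))) :
    c ∈ unrSelmer κ M vbar (∅ : Set (HeightOneSpectrum (𝓞 K))) ↔
      ∀ w ∈ Sf, ∀ i < N w,
        resOfLe M (inf_le_left : κ.kerSubgroup ⊓ decomp (K := K) w ≤ κ.kerSubgroup)
          (conjH1 κ.kerSubgroup M (γ ^ i) c) = 0 := by
  constructor
  · intro h w hw i _
    rw [unrSelmer, datumSelmerInfty_eq, mem_datumSelmer_iff, mem_unramifiedOutside_iff] at h
    have hD : ¬ decomp (K := K) w ≤ κ.kerSubgroup := fun hle ↦ by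
      obtain ⟨δ, hδ, hne⟩ := hSfdec w hw
      exact hne (ZpExtension.mem_kerSubgroup.mp (hle hδ))
    exact unramifiedKer_le_awayKer_of_not_decomp_le κ hstab hM
      (Iwasawa.inertia_le_kerSubgroup' κ w (hSfp w hw)) hD
      (h.1 w (Set.notMem_empty w) (hSfp w hw) (γ ^ i))
  · intro h
    rw [unrSelmer, mem_datumSelmerInfty_empty_iff κ M _ (↑Sf : Set (HeightOneSpectrum (𝓞 K)))]
    refine ⟨hc, fun w hw _ σ ↦ ?_⟩
    exact forall_conjH1_mem_unramifiedKer_of_forall_lt κ M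
      (hrep_numPlacesAbove κ hγ Sf hSfdec w (Finset.mem_coe.1 hw))
      (fun i hi ↦ mem_unramifiedKer_of_resOfLe_eq_zero κ w
        (h w (Finset.mem_coe.1 hw) i (by rw [hN w (Finset.mem_coe.1 hw)]; exact hi))) σ

/-- **The kernel of the canonical localisation `H¹_{𝓕_nr^{Sf}}(K_∞, M) → ∏_{w∈Sf} ∏_{i<[Γ:Γ_w]}
H¹(ker κ ⊓ D_w, M)`, `c ↦ (res_{ker κ ⊓ D_w} conj_{γ^i} c)_{w,i}`, IS `H¹_{𝓕_nr}(K_∞, M)`** (bundled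
form of `mem_unrSelmer_empty_iff_forall_resOfLe_conjH1_eq_zero`; hypotheses as there).
[cite: KellerYin2024, Prop. 1.2.5 (eq:Gr to imp) (arXiv:2402.12781v2 TeX L789–800)] [cite: GreenbergVatsal2000, §2 pp. 20–21] -/
theorem ker_pi_resOfLe_conjH1_eq
    (hstab : ∀ m : M, IsOpen (MulAction.stabilizer (absoluteGaloisGroup K) m : Set (absoluteGaloisGroup K)))
    (hM : ∀ m : M, ∃ k : ℕ, p ^ k • m = 0) {γ : absoluteGaloisGroup K} (hγ : κ.IsTopGenerator γ)
    (vbar : HeightOneSpectrum (𝓞 K)) (Sf : Finset (HeightOneSpectrum (𝓞 K)))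
    (hSfp : ∀ w ∈ Sf, ((p : ℕ) : 𝓞 K) ∉ w.asIdeal)
    (hSfdec : ∀ w ∈ Sf, ∃ δ ∈ decomp (K := K) w, κ δ ≠ 1)
    (N : HeightOneSpectrum (𝓞 K) → ℕ) (hN : ∀ w ∈ Sf, N w = numPlacesAbove κ w) :
    ((AddMonoidHom.pi fun w : ↥Sf ↦ AddMonoidHom.pi fun i : Fin (N (w : HeightOneSpectrum (𝓞 K))) ↦
        (resOfLe M (inf_le_left :
            κ.kerSubgroup ⊓ decomp (K := K) (w : HeightOneSpectrum (𝓞 K)) ≤ κ.kerSubgroup)).comp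
          (conjH1 κ.kerSubgroup M (γ ^ (i : ℕ)))).comp
      (unrSelmer κ M vbar (↑Sf : Set (HeightOneSpectrum (𝓞 K)))).subtype).ker =
      (unrSelmer κ M vbar (∅ : Set (HeightOneSpectrum (𝓞 K)))).addSubgroupOf
        (unrSelmer κ M vbar (↑Sf : Set (HeightOneSpectrum (𝓞 K)))) := by
  ext c
  rw [AddMonoidHom.mem_ker, AddSubgroup.mem_addSubgroupOf,
    mem_unrSelmer_empty_iff_forall_resOfLe_conjH1_eq_zero κ hstab hM hγ vbar Sf hSfp hSfdec N hN c.2]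
  constructor
  · intro h w hw i hi
    have h' := congrFun (congrFun h ⟨w, hw⟩) ⟨i, hi⟩
    exact h'
  · intro h
    funext w i
    exact h w w.2 i i.2

end Generic

/-! ## §2 `M = (F/𝒪)(θ)`: surjectivity of the canonical map ⇒ `Σ charLocalLambda ≤ zpCorank (Sel^{Sf}/Sel^∅)` -/

section Character

variable (θ : FramedGaloisRep K (padicCoeffIntegers (∅ : Set (PadicAlgCl p))) 1)
  (vbar : HeightOneSpectrum (𝓞 K)) (Sf : Finset (HeightOneSpectrum (𝓞 K)))

/-- **`Σ_{w∈Sf} charLocalLambda ∅ κ θ w ≤ zpCorank (H¹_{𝓕_nr^{Sf}}/H¹_{𝓕_nr}) p` from the SURJECTIVITY of the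
canonical localisation** `c ↦ (res_{ker κ ⊓ D_w} conj_{γ^i} c)_{w∈Sf, i<[Γ:Γ_w]}` on
`H¹_{𝓕_nr^{Sf}}(K_∞, (F/𝒪)(θ))` — `θ^{p−1} = 1`, `κ` any `ℤ_p`-extension with topological generator
`γ`, `Sf` a finite set of places `w ∤ p` finitely decomposed in `K_∞`. Kernel = `H¹_{𝓕_nr}` (§1, with
`(F/𝒪)(θ)` `p`-primary and open stabilisers), corank bookkeeping
(`UnrSelmerQuotientCorankGeOfSurjective`), per-place lower bound of KY Lemma 1.1.1
(`CharLocalTameCorank`). [cite: KellerYin2024, Prop. 1.2.5 and Lemma 1.1.1 (arXiv:2402.12781v2 TeX L780–800, L455–462)]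
[cite: CastellaGrossiLeeSkinner2022, Prop. 1.2.5 (eq:sur1)–(eq:sur2)] [cite: PollackWeston2011, App. A Prop. A.2] -/
theorem sum_charLocalLambda_le_zpCorank_unrSelmer_quotient_of_pi_surjective
    (hθ : ∀ σ : absoluteGaloisGroup K, θ σ ^ (p - 1) = 1) {γ : absoluteGaloisGroup K}
    (hγ : κ.IsTopGenerator γ) (hSfp : ∀ w ∈ Sf, ((p : ℕ) : 𝓞 K) ∉ w.asIdeal)
    (hSfdec : ∀ w ∈ Sf, ∃ δ ∈ decomp (K := K) w, κ δ ≠ 1)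
    (N : HeightOneSpectrum (𝓞 K) → ℕ) (hN : ∀ w ∈ Sf, N w = numPlacesAbove κ w)
    (hsurj : Surjective ((AddMonoidHom.pi fun w : ↥Sf ↦
        AddMonoidHom.pi fun i : Fin (N (w : HeightOneSpectrum (𝓞 K))) ↦
          (resOfLe (charModule (∅ : Set (PadicAlgCl p)) θ) (inf_le_left :
              κ.kerSubgroup ⊓ decomp (K := K) (w : HeightOneSpectrum (𝓞 K)) ≤ κ.kerSubgroup)).comp
            (conjH1 κ.kerSubgroup (charModule (∅ : Set (PadicAlgCl p)) θ) (γ ^ (i : ℕ)))).comp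
        (unrSelmer κ (charModule (∅ : Set (PadicAlgCl p)) θ) vbar
          (↑Sf : Set (HeightOneSpectrum (𝓞 K)))).subtype)) :
    ∑ w ∈ Sf, charLocalLambda (∅ : Set (PadicAlgCl p)) κ θ w ≤
      zpCorank (↥(unrSelmer κ (charModule (∅ : Set (PadicAlgCl p)) θ) vbar
          (↑Sf : Set (HeightOneSpectrum (𝓞 K)))) ⧸
        (unrSelmer κ (charModule (∅ : Set (PadicAlgCl p)) θ) vbar
          (∅ : Set (HeightOneSpectrum (𝓞 K)))).addSubgroupOf
            (unrSelmer κ (charModule (∅ : Set (PadicAlgCl p)) θ) vbar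
              (↑Sf : Set (HeightOneSpectrum (𝓞 K))))) p := by
  have hdec : ∀ w ∈ Sf, ¬ (decomp (K := K) w ≤ κ.kerSubgroup) := fun w hw hle ↦ by
    obtain ⟨δ, hδ, hne⟩ := hSfdec w hw
    exact hne (ZpExtension.mem_kerSubgroup.mp (hle hδ))
  exact sum_charLocalLambda_le_zpCorank_unrSelmer_quotient_of_surjective θ κ vbar Sf hθ hSfp hdec
    (fun w ↦ by rw [Fintype.card_fin, hN w w.2]) _ hsurj
    (ker_pi_resOfLe_conjH1_eq κ (GreenbergSelmer.isOpen_stabilizer_cofree (∅ : Set (PadicAlgCl p)) θ)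
      (GreenbergSelmer.exists_pow_smul_cofree_eq_zero (∅ : Set (PadicAlgCl p)) θ) hγ vbar Sf hSfp hSfdec N hN)

/-- **The conclusion of `KellerYin2024.prop125_residualPair_unrSelmer_corank_ge` from the surjectivity
of the canonical localisation ALONE**, under the stub's binders it uses: `K` imaginary quadratic,
`2 < p`, (Heeg) for `N`, `κ` anticyclotomic with topological generator `γ`, `θ ∈ {θsub, θquot}` of a
residual pair (`IsResidualPairOver`, so `θ^{p−1} = 1`), `Sf` = primes over `N` off `p` (finitely
decomposed in `K_∞^{ac}`, Brink 2007 via `exists_mem_decomp_apply_ne_one_of_heegner`). The remaining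
hypothesis `hsurj` is the `K_∞`-form of the global-to-local surjectivity (PW Prop. A.2 / Greenberg
Prop. 2.6.3 + [RH]). [cite: KellerYin2024, Prop. 1.2.5, Lemma 1.1.1, §1.4 (arXiv:2402.12781v2 TeX L780–800, L455–462, L1066–1081)]
[cite: CastellaGrossiLeeSkinner2022, Prop. 1.2.5] [cite: Brink2007, Thm. 2] [cite: PollackWeston2011, App. A Prop. A.2] -/
theorem sum_charLocalLambda_le_zpCorank_unrSelmer_quotient_at_residualPair_of_pi_surjective
    (hK : IsImaginaryQuadratic K) (hp2 : 2 < p) {N : ℕ} (hH : SatisfiesHeegnerHypothesis N K)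
    {WK : WeierstrassCurve K} (hκ : κ.IsAnticyclotomic) {γ : absoluteGaloisGroup K}
    (hγ : κ.IsTopGenerator γ)
    (θsub θquot : FramedGaloisRep K (padicCoeffIntegers (∅ : Set (PadicAlgCl p))) 1)
    (hpair : IsResidualPairOver WK p θsub θquot)
    (hSf : ∀ w : HeightOneSpectrum (𝓞 K), w ∈ Sf ↔ ((N : ℤ) : 𝓞 K) ∈ w.asIdeal)
    (hSp : ∀ w ∈ Sf, ((p : ℕ) : 𝓞 K) ∉ w.asIdeal) (hθ : θ = θsub ∨ θ = θquot)
    (N : HeightOneSpectrum (𝓞 K) → ℕ) (hN : ∀ w ∈ Sf, N w = numPlacesAbove κ w)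
    (hsurj : Surjective ((AddMonoidHom.pi fun w : ↥Sf ↦
        AddMonoidHom.pi fun i : Fin (N (w : HeightOneSpectrum (𝓞 K))) ↦
          (resOfLe (charModule (∅ : Set (PadicAlgCl p)) θ) (inf_le_left :
              κ.kerSubgroup ⊓ decomp (K := K) (w : HeightOneSpectrum (𝓞 K)) ≤ κ.kerSubgroup)).comp
            (conjH1 κ.kerSubgroup (charModule (∅ : Set (PadicAlgCl p)) θ) (γ ^ (i : ℕ)))).comp
        (unrSelmer κ (charModule (∅ : Set (PadicAlgCl p)) θ) vbar
          (↑Sf : Set (HeightOneSpectrum (𝓞 K)))).subtype)) :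
    ∑ w ∈ Sf, charLocalLambda (∅ : Set (PadicAlgCl p)) κ θ w ≤
      zpCorank (↥(unrSelmer κ (charModule (∅ : Set (PadicAlgCl p)) θ) vbar
          (↑Sf : Set (HeightOneSpectrum (𝓞 K)))) ⧸
        (unrSelmer κ (charModule (∅ : Set (PadicAlgCl p)) θ) vbar
          (∅ : Set (HeightOneSpectrum (𝓞 K)))).addSubgroupOf
            (unrSelmer κ (charModule (∅ : Set (PadicAlgCl p)) θ) vbar
              (↑Sf : Set (HeightOneSpectrum (𝓞 K))))) p := by
  have hθ' : ∀ σ : absoluteGaloisGroup K, θ σ ^ (p - 1) = 1 := fun σ ↦ by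
    rcases hθ with rfl | rfl
    · exact (hpair.pow_sub_one σ).1
    · exact (hpair.pow_sub_one σ).2
  exact sum_charLocalLambda_le_zpCorank_unrSelmer_quotient_of_pi_surjective κ θ vbar Sf hθ' hγ hSp
    (fun w hw ↦ UnrSelmerQuotientTorsionFiniteChar.exists_mem_decomp_apply_ne_one_of_heegner hK hp2 hH κ
      hκ w ((hSf w).mp hw) (hSp w hw)) N hN hsurj

end Character

end Summit.BirchSwinnertonDyer.BirchSwinnertonDyer.Theorems.UnrSelmerNaturalLocalization

end
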